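import Literature.Analysis.DeBrangesSpaces.BurnolSonineStructurePsiProofs
import Literature.Analysis.DeBrangesSpaces.BurnolXPairingRepresenters
import Literature.NumberTheory.LFunctions.SonineMellinFunctionalEquation
import Literature.NumberTheory.LFunctions.BurnolEvaluatorProofs
import Literature.NumberTheory.LFunctions.BurnolSonineFourier
import Mathlib.MeasureTheory.Measure.OpenPos
import HarnessLib

/-!
# Burnol 2002 (CRAS 335), Théorème 9: `ℰ_λ(w) = √λ ×` (the jump of the euclidean evaluator `Z_w^λ`
# at `t = λ`) — the evaluators made explicit, their continuous representative on `(λ,∞)`, and the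
# identity with the printed structure function

LINE 1 — LABEL: **RH-FREE** (Fourier/Mellin analysis of the Sonine spaces `K_λ` of even square integrable
functions vanishing on `(−λ,λ)` together with their cosine transform; the Riemann zeta function does not
occur). FRAMING (cell rh-crit, D-0074): corpus theorems are RH-FREE literature; nothing here is worded as
progress toward RH. bears_on: B-C/B-P (LADDER-RH COLUMN 6, de Branges framework) as corpus vocabulary.
WHAT THIS IS NOT: not a route, not a criterion, no positivity condition at `E_ζ`; an identity between
Burnol's explicit structure function `ℰ_λ` and his evaluators moves RH by nothing. Nothing here bears on
the truth of RH.

Source. J.-F. Burnol, *Sur les « espaces de Sonine » associés par de Branges à la transformation de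
Fourier*, C. R. Math. Acad. Sci. Paris **335** (2002) 689–692 = arXiv:math/0208121 [Burnol2002CRAS]
(TeX of record `rh-crit/dbl/src/Burnol2002CRAS_arXivmath0208121.tex`): the proof sketch TeX l.398–421
("On notera `X_w^λ(t)` l'unique élément de `K_λ` tel que `∀ f ∈ K_λ ∫_0^∞ f(t)t^{−w}dt = ∫_0^∞ f(t)X_w(t)dt`
(pour `Re(w) ≤ 1/2` la première intégrale est un prolongement analytique). Pour `Re(w) > 1/2` la formule
pour la projection orthogonale permet d'écrire explicitement `X_w^λ(t)`, et on voit en particulier que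
`X_w^λ(t) − t^{−w}` est la restriction à `t > λ` d'une fonction entière") and Théorème 9 (TeX l.424–428:
"Il y a coïncidence entre `ℰ_λ(w)` et `√λ` fois la valeur du saut de l'évaluateur euclidien
`Z_w^λ(t) = π^{−w/2}Γ(w/2)X_w^λ(t)` en `t = λ`"). The Note prints no proof of Théorème 9 beyond this sketch
("Une étude plus poussée permet d'affirmer …"), and the companion paper J.-F. Burnol, *On Fourier and
Zeta(s)*, Forum Math. 16 (2004) = arXiv:math/0112254 [Burnol2004], §6 (TeX of record
`dbl/src/Burnol2004ForumMath_arXivmath0112254.tex` l.2280–2286) only refers back to the Note ("The next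
step is to actually write down explicitely the associated orthogonal projection. This has led the author
recently to advances in the theory of the de Branges Sonine spaces [cras3]"); the road below is therefore
assembled from the landed corpus tools (Corollaire 5 and the functional equation), following the sketch
sentence by sentence where it is explicit.

## What is PROVED (theorems only; no definition, no new named fact)

Namespace `Literature.Analysis.DeBrangesSpaces.Burnol2002` (the typed statements live in
`BurnolSonineStructureFunction.lean`).

* §A Operator calculus for the euclidean BILINEAR pairing `B(u,v) = ∫_ℝ u v` on `L²(ℝ)`: `P_λ`, `𝓕`,
  `F_λ = P_λ𝓕P_λ`, `D_λ = F_λ²` and the resolvent `(1 − D_λ)^{-1}` are `B`-symmetric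
  (`integral_cutoffProj_mul`, …, `integral_resolvent_mul`); `(1 − D_λ)^{-1} P_λ(2cos 2πλ·) = ½(h_+ + h_−)`
  (`resolvent_cosCut`).
* §B The evaluators. `isCompletedRightMellin_completedMellinEntire`: for `f ∈ K_λ` the entire completed
  right Mellin transform `𝒢_f = completedMellinEntire f` of `BurnolSonineZeros.lean` IS a witness of the
  Note's `IsCompletedRightMellin`, and any witness equals it; hence `isSonineZ_iff`: the Note's evaluator
  predicate `IsSonineZ λ w Z` is `Z ∈ K_λ ∧ ∀ f ∈ K_λ, ∫_0^∞ fZ = 𝒢_f(w)`, and `IsSonineZ.unique`.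
* §C EXPLICIT EVALUATORS at every `w ∈ ℂ` (this is the sketch's "la formule pour la projection orthogonale
  permet d'écrire explicitement `X_w^λ`", extended to all `w` by the functional equation): for an even
  `L²` representer `q` vanishing on `[−λ,λ]`, `∫_0^∞ f·π_λ(q) = ∫_0^∞ f·q` on `K_λ`
  (`setIntegral_Ioi_mul_soninProjection`); the A-branch representer `Γ_ℝ(w)𝟙_{|t|>λ}|t|^{−w}` (`Re w > 1/2`)
  and the B-branch representer `Γ_ℝ(1−w)𝟙_{|t|>λ}C_λ(t,w)` (`w ∉ 1 + 2ℕ`, `C_λ` = the lineage's entire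
  cosine kernel `SonineMellin.cosKernel`) both pair with `f ∈ K_λ` to `𝒢_f(w)`
  (`Gammaℝ_mul_setIntegral_cpow_eq`, `Gammaℝ_mul_setIntegral_cosKernel_eq`, via
  `completedMellinEntire_eq_Gammaℝ_mul_of_mem_sonineK` and the functional equation
  `completedMellinEntire_fourier_eq_of_mem_sonineK`); so `π_λ` of either IS the evaluator
  (`isSonineZ_reprA`, `isSonineZ_reprB`) — in particular the evaluator EXISTS at every `w ∈ ℂ`.
* §D THE JUMP: by Corollaire 5 (i) (`soninProjection_eq_cor5_1`; here `soninProjection_ae_eq_Ioi`),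
  `π_λ(q) = q − 𝓕R_q` a.e. on `|t| > λ`
  with `R_q = (1−D_λ)^{-1}P_λ𝓕q ∈ P_λL²`, whose Fourier transform has the entire representative
  `Φ(t) = ∫_{[−λ,λ]} R_q(y)e^{2πity}dy` (`fourier_coeFn_ae_eq_setIntegral`); the jump at `λ` of `π_λ(q)` is
  `q(λ⁺) − Φ(λ)` and — the heart of the matter — `Φ(λ) = −½∫_λ^∞ q(t)(ψ_+^λ − ψ_−^λ)(t)dt`
  (`fourierResolvent_apply_self`: `B`-symmetry moves `(1−D_λ)^{-1}P_λ𝓕` onto `P_λ(2cos 2πλ·)`, producing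
  `½(𝓕h_+ + 𝓕h_−) = −½(ψ_+ − ψ_−)` on `ℝ`).
* §E Théorème 9 on `Re w > 1/2` (`exists_jump_repr`, `sonineE_eq_sqrt_mul_jump_of_re_gt_half`): with
  `q = Γ_ℝ(w)𝟙|t|^{−w}` the jump is `Γ_ℝ(w)(λ^{−w} + ½∫_λ^∞(ψ_+ − ψ_−)t^{−w}dt)`, i.e. `√λ ×` jump
  `= sonineEFormula λ w` (`sonineEFormula_eq_sqrt_mul_jump`), the printed formula of Théorème 8
  (absolutely convergent there by Cauchy–Schwarz, `integrableOn_psi_mul_cpow`).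
* §F Théorème 9 everywhere (`Burnol2002CRAS_thm9_holds`): on `Re w < 1` the B-branch jump
  `c_B(w) = Γ_ℝ(1−w)(C_λ(λ,w) + ½·sonineMellinExt λ λ m w)` (`m = ψ_+ − ψ_−` as an `L²` class) is holomorphic
  (`differentiableOn_jumpB`, from `differentiable_sonineMellinExt`); on the strip `1/2 < Re w < 1` both
  branches give THE evaluator (uniqueness), hence the same jump (`jump_unique`, `jumpA_eq_jumpB`), hence
  `ℰ = √λ·c_B` there; `ℰ` being entire, the identity theorem on the half-plane `Re w < 1` finishes
  (`sonineE_eq_sqrt_mul_jumpB`).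

Deviation from the sketch (said once): Burnol reaches Théorèmes 8–9 through the distribution
`(t d/dt + w)X_w^λ` and the Sonine distributions `A_λ`, `−iB_λ`; here Théorème 9 alone is proved, directly
from the projection formula and the `B`-symmetry of the operators involved, the continuation to
`Re w ≤ 1/2` being done with the already-landed functional equation rather than with distributions.
-/

noncomputable section

open _root_.MeasureTheory _root_.Complex _root_.Set _root_.Filter
open scoped Real Topology FourierTransform ComplexConjugate
open Literature.NumberTheory.LFunctions (evenL2 sonineK completedMellinEntire
  HasCompletedMellinEntire sonineK_eq_soninSpace fourier_mem_evenL2 fourier_fourier_eq_self_of_mem_evenL2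
  fourier_mem_sonineK smul_mem_evenL2 smul_mem_sonineK add_mem_evenL2 add_mem_sonineK zero_mem_sonineK
  isClosed_sonineK hasCompletedMellinEntire_of_mem_sonineK completedMellinEntire_eq_Gammaℝ_mul_of_mem_sonineK
  completedMellinEntire_fourier_eq_of_mem_sonineK)
open Literature.NumberTheory.LFunctions.BurnolEvaluators (exists_conj mem_evenL2_of_conj mem_sonineK_of_conj
  sub_mem_sonineK eq_of_pairing_eq)
open Literature.NumberTheory.ConnesConsani2021 (cutoffProj soninSpace soninProjection
  cutoffProj_coeFn mem_soninSpace_iff soninProjection_mem soninProjection_eq_self_iff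
  soninProjection_isSymmetric cutoffProj_idem)
open Literature.Analysis.Fourier (coeFn_compNeg compNeg_compNeg fourier_compNeg integral_mul_fourier_eq)
open Literature.Analysis.DeBrangesSpaces.SonineMellin (cosKernel cosKernel_neg differentiable_cosKernel
  continuousOn_cosKernel sonineMellinExt differentiable_sonineMellinExt sonineMellinExt_eq_mellin)

namespace Literature.Analysis.DeBrangesSpaces

namespace Burnol2002

/-! ## §A. Operator calculus: the resolvent `(1 − D_λ)^{-1}` and `B`-symmetry -/

/-- `P_λ (P_λ z) = P_λ z`. [cite: Burnol2002CRAS, §3 (TeX l.259–262)] -/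
private theorem cutoffProj_cutoffProj'' (lam : ℝ) (z : Lp ℂ 2 (volume : Measure ℝ)) :
    cutoffProj lam (cutoffProj lam z) = cutoffProj lam z := by
  have h := congrArg (fun T : Lp ℂ 2 (volume : Measure ℝ) →L[ℂ] Lp ℂ 2 (volume : Measure ℝ) ↦ T z)
    (cutoffProj_idem lam).eq
  simpa only [mul_apply_eq_comp] using h

/-- `(1 − D_λ)^{-1}((1 − D_λ) z) = z` and `(1 − D_λ)((1 − D_λ)^{-1} z) = z`.
[cite: Burnol2002CRAS, Théorème 4 (TeX l.310–319)] -/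
theorem resolvent_apply' (lam : ℝ) (z : Lp ℂ 2 (volume : Measure ℝ)) :
    Ring.inverse (1 - slepianD lam) (z - slepianD lam z) = z ∧
      Ring.inverse (1 - slepianD lam) z - slepianD lam (Ring.inverse (1 - slepianD lam) z) = z := by
  have h1 := Ring.inverse_mul_cancel _ (isUnit_one_sub_slepianD lam)
  have h2 := Ring.mul_inverse_cancel _ (isUnit_one_sub_slepianD lam)
  have e1 := congrArg (fun T : Lp ℂ 2 (volume : Measure ℝ) →L[ℂ] Lp ℂ 2 (volume : Measure ℝ) ↦ T z) h1
  have e2 := congrArg (fun T : Lp ℂ 2 (volume : Measure ℝ) →L[ℂ] Lp ℂ 2 (volume : Measure ℝ) ↦ T z) h2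
  simp only [mul_apply_eq_comp, sub_apply,
    one_apply_eq_self] at e1 e2
  exact ⟨e1, e2⟩

/-- `(1 − D_λ)^{-1}` maps `ran P_λ` into itself: `P_λ((1 − D_λ)^{-1} z) = (1 − D_λ)^{-1} z` when
`P_λ z = z` (`P_λ D_λ = D_λ`). [cite: Burnol2002CRAS, Théorème 4 (TeX l.310–319)] -/
theorem cutoffProj_resolvent' {lam : ℝ} {z : Lp ℂ 2 (volume : Measure ℝ)}
    (hz : cutoffProj lam z = z) :
    cutoffProj lam (Ring.inverse (1 - slepianD lam) z) = Ring.inverse (1 - slepianD lam) z := by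
  set y := Ring.inverse (1 - slepianD lam) z with hy
  have h2 := (resolvent_apply' lam z).2
  have hyz : y = z + slepianD lam y := by rw [← hy] at h2; exact (sub_eq_iff_eq_add.1 h2)
  have hPD : cutoffProj lam (slepianD lam y) = slepianD lam y := by
    rw [slepianD_apply, slepianF_apply, cutoffProj_cutoffProj'']
  rw [hyz, map_add, hz, hPD]

/-- `R(F_λ z) = F_λ(R z)` for the reflection `R`. [folklore] -/
private theorem compNeg_slepianF'' (lam : ℝ) (z : Lp ℂ 2 (volume : Measure ℝ)) :
    Lp.compMeasurePreserving (fun x : ℝ ↦ -x) (Measure.measurePreserving_neg (volume : Measure ℝ))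
        (slepianF lam z) =
      slepianF lam (Lp.compMeasurePreserving (fun x : ℝ ↦ -x)
        (Measure.measurePreserving_neg (volume : Measure ℝ)) z) := by
  rw [slepianF_apply, slepianF_apply,
    Literature.NumberTheory.ConnesConsani2021.compNeg_cutoffProj, ← fourier_compNeg,
    Literature.NumberTheory.ConnesConsani2021.compNeg_cutoffProj]

/-- `R(D_λ z) = D_λ(R z)`. [folklore] -/
private theorem compNeg_slepianD'' (lam : ℝ) (z : Lp ℂ 2 (volume : Measure ℝ)) :
    Lp.compMeasurePreserving (fun x : ℝ ↦ -x) (Measure.measurePreserving_neg (volume : Measure ℝ))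
        (slepianD lam z) =
      slepianD lam (Lp.compMeasurePreserving (fun x : ℝ ↦ -x)
        (Measure.measurePreserving_neg (volume : Measure ℝ)) z) := by
  rw [slepianD_apply, slepianD_apply, compNeg_slepianF'', compNeg_slepianF'']

/-- `R((1 − D_λ)^{-1} z) = (1 − D_λ)^{-1}(R z)`. [folklore] -/
private theorem compNeg_resolvent' (lam : ℝ) (z : Lp ℂ 2 (volume : Measure ℝ)) :
    Lp.compMeasurePreserving (fun x : ℝ ↦ -x) (Measure.measurePreserving_neg (volume : Measure ℝ))
        (Ring.inverse (1 - slepianD lam) z) =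
      Ring.inverse (1 - slepianD lam) (Lp.compMeasurePreserving (fun x : ℝ ↦ -x)
        (Measure.measurePreserving_neg (volume : Measure ℝ)) z) := by
  set R' := Lp.compMeasurePreserving (fun x : ℝ ↦ -x) (Measure.measurePreserving_neg (volume : Measure ℝ))
    (E := ℂ) (p := (2 : ENNReal)) with hR'
  set y := Ring.inverse (1 - slepianD lam) z with hy
  have h2 : y - slepianD lam y = z := (resolvent_apply' lam z).2
  have h3 : R' y - slepianD lam (R' y) = R' z := by
    rw [← compNeg_slepianD'', ← map_sub, h2]
  have h4 := (resolvent_apply' lam (R' y)).1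
  rw [h3] at h4
  exact h4.symm

/-- An `L²` class fixed by the reflection is even. [folklore] -/
private theorem mem_evenL2_of_compNeg_eq {u : Lp ℂ 2 (volume : Measure ℝ)}
    (hu : Lp.compMeasurePreserving (fun x : ℝ ↦ -x) (Measure.measurePreserving_neg (volume : Measure ℝ))
      u = u) : u ∈ evenL2 := by
  have h := coeFn_compNeg (F := ℂ) u
  rw [hu] at h
  show ∀ᵐ x : ℝ, (u : ℝ → ℂ) (-x) = (u : ℝ → ℂ) x
  filter_upwards [h] with x hx
  exact hx.symm

/-- An even `L²` class is fixed by the reflection. [folklore] -/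
private theorem compNeg_eq_of_mem_evenL2' {u : Lp ℂ 2 (volume : Measure ℝ)} (hu : u ∈ evenL2) :
    Lp.compMeasurePreserving (fun x : ℝ ↦ -x) (Measure.measurePreserving_neg (volume : Measure ℝ))
      u = u := by
  refine Lp.ext ?_
  have hu' : ∀ᵐ x : ℝ, (u : ℝ → ℂ) (-x) = (u : ℝ → ℂ) x := hu
  filter_upwards [coeFn_compNeg (F := ℂ) u, hu'] with x hx he
  rw [hx, he]

/-- `P_λ` preserves evenness. [folklore] -/
private theorem cutoffProj_mem_evenL2 (lam : ℝ) {u : Lp ℂ 2 (volume : Measure ℝ)} (hu : u ∈ evenL2) :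
    cutoffProj lam u ∈ evenL2 := by
  refine mem_evenL2_of_compNeg_eq ?_
  rw [Literature.NumberTheory.ConnesConsani2021.compNeg_cutoffProj, compNeg_eq_of_mem_evenL2' hu]

/-- `(1 − D_λ)^{-1}` preserves evenness. [folklore] -/
private theorem resolvent_mem_evenL2 (lam : ℝ) {u : Lp ℂ 2 (volume : Measure ℝ)} (hu : u ∈ evenL2) :
    Ring.inverse (1 - slepianD lam) u ∈ evenL2 := by
  refine mem_evenL2_of_compNeg_eq ?_
  rw [compNeg_resolvent', compNeg_eq_of_mem_evenL2' hu]

/-- **`(1 − D_λ)^{-1} P_λ(2cos 2πλ·) = ½(h_+^λ + h_−^λ)`**: `(1 − D_λ)(h_+ + h_−) =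
(1 − F_λ)(1 + F_λ)h_+ + (1 + F_λ)(1 − F_λ)h_− = (1 − F_λ)P_λ(2cos) + (1 + F_λ)P_λ(2cos) = 2P_λ(2cos)`.
[cite: Burnol2002CRAS, Définition 2 (TeX l.361–367)] -/
theorem resolvent_cosCut (lam : ℝ) :
    Ring.inverse (1 - slepianD lam) (cosCut lam) = (1 / 2 : ℂ) • (hPlus lam + hMinus lam) := by
  have hP := hPlus_add_slepianF lam
  have hM := hMinus_sub_slepianF lam
  -- `D(h₊ + h₋) = h₊ + h₋ − 2 cosCut`
  have hD : slepianD lam (hPlus lam + hMinus lam) = hPlus lam + hMinus lam - (2 : ℂ) • cosCut lam := by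
    have e1 : slepianF lam (hPlus lam) = cosCut lam - hPlus lam := eq_sub_of_add_eq' hP
    have e2 : slepianF lam (hMinus lam) = hMinus lam - cosCut lam := by
      rw [← hM]; abel
    rw [slepianD_apply, map_add, e1, e2, map_add, map_sub, map_sub, e1, e2]
    rw [two_smul]; abel
  have h1 : (hPlus lam + hMinus lam) - slepianD lam (hPlus lam + hMinus lam) = (2 : ℂ) • cosCut lam := by
    rw [hD]; abel
  have h2 := (resolvent_apply' lam (hPlus lam + hMinus lam)).1
  rw [h1, map_smul] at h2
  have h3 := congrArg (fun v ↦ (1 / 2 : ℂ) • v) h2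
  simp only [smul_smul] at h3
  norm_num at h3
  rw [smul_add]
  exact h3

/-! ### `B`-symmetry of `P_λ`, `𝓕`, `F_λ`, `D_λ`, `(1 − D_λ)^{-1}` for `B(u,v) = ∫_ℝ uv` -/

/-- Products of `L²` classes are integrable. [folklore] -/
private theorem integrable_mul_Lp (u v : Lp ℂ 2 (volume : Measure ℝ)) :
    Integrable (fun x : ℝ ↦ (u : ℝ → ℂ) x * (v : ℝ → ℂ) x) :=
  (Lp.memLp u).integrable_mul (Lp.memLp v)

/-- `B(u − u', v) = B(u, v) − B(u', v)`. [folklore] -/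
private theorem integral_sub_mul (u u' v : Lp ℂ 2 (volume : Measure ℝ)) :
    ∫ x, ((u - u' : Lp ℂ 2 (volume : Measure ℝ)) : ℝ → ℂ) x * (v : ℝ → ℂ) x =
      (∫ x, (u : ℝ → ℂ) x * (v : ℝ → ℂ) x) - ∫ x, (u' : ℝ → ℂ) x * (v : ℝ → ℂ) x := by
  rw [← integral_sub (integrable_mul_Lp u v) (integrable_mul_Lp u' v)]
  refine integral_congr_ae ?_
  filter_upwards [Lp.coeFn_sub u u'] with x hx
  rw [hx, Pi.sub_apply, sub_mul]

/-- `B(u, v − v') = B(u, v) − B(u, v')`. [folklore] -/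
private theorem integral_mul_sub' (u v v' : Lp ℂ 2 (volume : Measure ℝ)) :
    ∫ x, (u : ℝ → ℂ) x * ((v - v' : Lp ℂ 2 (volume : Measure ℝ)) : ℝ → ℂ) x =
      (∫ x, (u : ℝ → ℂ) x * (v : ℝ → ℂ) x) - ∫ x, (u : ℝ → ℂ) x * (v' : ℝ → ℂ) x := by
  rw [← integral_sub (integrable_mul_Lp u v) (integrable_mul_Lp u v')]
  refine integral_congr_ae ?_
  filter_upwards [Lp.coeFn_sub v v'] with x hx
  rw [hx, Pi.sub_apply, mul_sub]

/-- **`P_λ` is `B`-symmetric**: `∫ (P_λ u) v = ∫ u (P_λ v)`. [cite: Burnol2002CRAS, §3 (TeX l.259–262)] -/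
theorem integral_cutoffProj_mul (lam : ℝ) (u v : Lp ℂ 2 (volume : Measure ℝ)) :
    ∫ x, ((cutoffProj lam u : Lp ℂ 2 (volume : Measure ℝ)) : ℝ → ℂ) x * (v : ℝ → ℂ) x =
      ∫ x, (u : ℝ → ℂ) x * ((cutoffProj lam v : Lp ℂ 2 (volume : Measure ℝ)) : ℝ → ℂ) x := by
  refine integral_congr_ae ?_
  filter_upwards [cutoffProj_coeFn lam u, cutoffProj_coeFn lam v] with x h1 h2
  rw [h1, h2]
  by_cases hx : x ∈ Icc (-lam) lam
  · rw [Set.indicator_of_mem hx, Set.indicator_of_mem hx]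
  · rw [Set.indicator_of_notMem hx, Set.indicator_of_notMem hx, zero_mul, mul_zero]

/-- **`𝓕` is `B`-symmetric** (`L²` multiplication formula): `∫ (𝓕u) v = ∫ u (𝓕v)`.
[cite: Burnol2002CRAS, §2 (TeX l.174, 207–210)] -/
theorem integral_fourierL2_mul (u v : Lp ℂ 2 (volume : Measure ℝ)) :
    ∫ x, ((fourierL2 u : Lp ℂ 2 (volume : Measure ℝ)) : ℝ → ℂ) x * (v : ℝ → ℂ) x =
      ∫ x, (u : ℝ → ℂ) x * ((fourierL2 v : Lp ℂ 2 (volume : Measure ℝ)) : ℝ → ℂ) x := by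
  rw [fourierL2_apply, fourierL2_apply]
  exact (integral_mul_fourier_eq (V := ℝ) u v).symm

/-- **`F_λ = P_λ𝓕P_λ` is `B`-symmetric.** [cite: Burnol2002CRAS, Lemme 2, proof (TeX l.279–281)] -/
theorem integral_slepianF_mul (lam : ℝ) (u v : Lp ℂ 2 (volume : Measure ℝ)) :
    ∫ x, ((slepianF lam u : Lp ℂ 2 (volume : Measure ℝ)) : ℝ → ℂ) x * (v : ℝ → ℂ) x =
      ∫ x, (u : ℝ → ℂ) x * ((slepianF lam v : Lp ℂ 2 (volume : Measure ℝ)) : ℝ → ℂ) x := by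
  rw [slepianF_apply, slepianF_apply, ← fourierL2_apply, ← fourierL2_apply, integral_cutoffProj_mul,
    integral_fourierL2_mul, integral_cutoffProj_mul]

/-- **`D_λ = F_λ²` is `B`-symmetric.** [cite: Burnol2002CRAS, Lemme 2, proof (TeX l.283–285)] -/
theorem integral_slepianD_mul (lam : ℝ) (u v : Lp ℂ 2 (volume : Measure ℝ)) :
    ∫ x, ((slepianD lam u : Lp ℂ 2 (volume : Measure ℝ)) : ℝ → ℂ) x * (v : ℝ → ℂ) x =
      ∫ x, (u : ℝ → ℂ) x * ((slepianD lam v : Lp ℂ 2 (volume : Measure ℝ)) : ℝ → ℂ) x := by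
  rw [slepianD_apply, slepianD_apply, integral_slepianF_mul, integral_slepianF_mul]

/-- **`(1 − D_λ)^{-1}` is `B`-symmetric**: `B(Au, v) = B(Au, (1−D)Av) = B((1−D)Au, Av) = B(u, Av)`.
[cite: Burnol2002CRAS, Théorème 4 (TeX l.310–319)] -/
theorem integral_resolvent_mul (lam : ℝ) (u v : Lp ℂ 2 (volume : Measure ℝ)) :
    ∫ x, ((Ring.inverse (1 - slepianD lam) u : Lp ℂ 2 (volume : Measure ℝ)) : ℝ → ℂ) x *
        (v : ℝ → ℂ) x =
      ∫ x, (u : ℝ → ℂ) x *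
        ((Ring.inverse (1 - slepianD lam) v : Lp ℂ 2 (volume : Measure ℝ)) : ℝ → ℂ) x := by
  set A := Ring.inverse (1 - slepianD lam) with hA
  have hv : A v - slepianD lam (A v) = v := (resolvent_apply' lam v).2
  have hu : A u - slepianD lam (A u) = u := (resolvent_apply' lam u).2
  calc ∫ x, ((A u : Lp ℂ 2 (volume : Measure ℝ)) : ℝ → ℂ) x * (v : ℝ → ℂ) x
      = ∫ x, ((A u : Lp ℂ 2 (volume : Measure ℝ)) : ℝ → ℂ) x *
          ((A v - slepianD lam (A v) : Lp ℂ 2 (volume : Measure ℝ)) : ℝ → ℂ) x := by rw [hv]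
    _ = (∫ x, ((A u : Lp ℂ 2 (volume : Measure ℝ)) : ℝ → ℂ) x *
          ((A v : Lp ℂ 2 (volume : Measure ℝ)) : ℝ → ℂ) x) -
          ∫ x, ((A u : Lp ℂ 2 (volume : Measure ℝ)) : ℝ → ℂ) x *
            ((slepianD lam (A v) : Lp ℂ 2 (volume : Measure ℝ)) : ℝ → ℂ) x := integral_mul_sub' _ _ _
    _ = (∫ x, ((A u : Lp ℂ 2 (volume : Measure ℝ)) : ℝ → ℂ) x *
          ((A v : Lp ℂ 2 (volume : Measure ℝ)) : ℝ → ℂ) x) -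
          ∫ x, ((slepianD lam (A u) : Lp ℂ 2 (volume : Measure ℝ)) : ℝ → ℂ) x *
            ((A v : Lp ℂ 2 (volume : Measure ℝ)) : ℝ → ℂ) x := by rw [integral_slepianD_mul]
    _ = ∫ x, ((A u - slepianD lam (A u) : Lp ℂ 2 (volume : Measure ℝ)) : ℝ → ℂ) x *
          ((A v : Lp ℂ 2 (volume : Measure ℝ)) : ℝ → ℂ) x := (integral_sub_mul _ _ _).symm
    _ = ∫ x, (u : ℝ → ℂ) x * ((A v : Lp ℂ 2 (volume : Measure ℝ)) : ℝ → ℂ) x := by rw [hu]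

/-! ## §B. The bilinear pairing on `(0,∞)` and the Note's evaluator predicate -/

/-- For even classes `f, g` and `v = conj f` (a.e.): `∫_0^∞ f g = ½⟪v, g⟫`.
[cite: Burnol2004b, §2 (arXiv:math/0203120v7 p. 5, TeX l.477–481)] -/
theorem setIntegral_Ioi_mul_eq_half_inner {f g v : Lp ℂ 2 (volume : Measure ℝ)} (hf : f ∈ evenL2)
    (hg : g ∈ evenL2) (hv : (v : ℝ → ℂ) =ᵐ[volume] fun x ↦ conj ((f : ℝ → ℂ) x)) :
    ∫ t in Ioi (0 : ℝ), (f : ℝ → ℂ) t * (g : ℝ → ℂ) t = (1 / 2 : ℂ) * inner ℂ v g := by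
  have hve : v ∈ evenL2 := mem_evenL2_of_conj hf hv
  rw [← Literature.NumberTheory.LFunctions.BurnolEvaluators.setIntegral_mul_conj_eq_half_inner hg hve]
  refine integral_congr_ae (ae_restrict_of_ae ?_)
  filter_upwards [hv] with t ht
  rw [ht, Complex.conj_conj, mul_comm]

/-- **Projecting the representer does not change the pairing on `K_λ`**: for `f ∈ K_λ` and an even
class `q`, `∫_0^∞ f·π_λ(q) = ∫_0^∞ f·q` (`π_λ` is self-adjoint and fixes `conj f ∈ K_λ`). This is why
"the orthogonal projection of `X_w^λ` onto `K_λ`" IS the evaluator. [cite: Burnol2002CRAS, Théorème 9 (TeX l.398–404)] -/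
theorem setIntegral_Ioi_mul_soninProjection {lam : ℝ} {f q : Lp ℂ 2 (volume : Measure ℝ)}
    (hf : f ∈ sonineK lam) (hq : q ∈ evenL2) :
    ∫ t in Ioi (0 : ℝ), (f : ℝ → ℂ) t * ((soninProjection lam lam q : Lp ℂ 2 (volume : Measure ℝ)) :
        ℝ → ℂ) t = ∫ t in Ioi (0 : ℝ), (f : ℝ → ℂ) t * (q : ℝ → ℂ) t := by
  obtain ⟨v, hv⟩ := exists_conj f
  have hvK : v ∈ sonineK lam := mem_sonineK_of_conj hf hv
  have hvS : v ∈ soninSpace lam lam := by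
    have := hvK; rw [sonineK_eq_soninSpace] at this; exact this
  have hπq : soninProjection lam lam q ∈ evenL2 := by
    have hm := soninProjection_mem lam lam q
    have : soninProjection lam lam q ∈ sonineK lam := by rw [sonineK_eq_soninSpace]; exact hm
    exact this.1
  rw [setIntegral_Ioi_mul_eq_half_inner hf.1 hπq hv, setIntegral_Ioi_mul_eq_half_inner hf.1 hq hv]
  congr 1
  have hsym := soninProjection_isSymmetric lam lam
  have hfix : soninProjection lam lam v = v := soninProjection_eq_self_iff.mpr hvS
  calc inner ℂ v (soninProjection lam lam q)
      = inner ℂ (soninProjection lam lam v) q := (hsym v q).symm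
    _ = inner ℂ v q := by rw [hfix]

/-- For `f ∈ K_λ`, the canonical entire completed Mellin transform `𝒢_f = completedMellinEntire f`
(`BurnolSonineZeros.lean`; de Branges / Burnol 2004 Thm. 2.1) IS a witness of the Note's
`IsCompletedRightMellin`: it is entire and equals `Γ_ℝ(w)·∫_0^∞ f(t)t^{−w}dt` on the WHOLE half-plane
`Re w > 1/2` (the explicit form `Γ_ℝ(w)·G(1−w)` with `G` the entire continuation of the left Mellin
transform, and `G = mellin f` on `Re < 1/2`). [cite: Burnol2002CRAS, §2 (TeX l.236–238)] -/
theorem isCompletedRightMellin_completedMellinEntire {lam : ℝ} (hlam : 0 < lam)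
    {f : Lp ℂ 2 (volume : Measure ℝ)} (hf : f ∈ sonineK lam) :
    IsCompletedRightMellin f (completedMellinEntire (f : ℝ → ℂ)) := by
  have hfS : f ∈ soninSpace lam lam := by
    have := hf; rw [sonineK_eq_soninSpace] at this; exact this
  obtain ⟨heven, hfa, hFa⟩ := (mem_soninSpace_iff lam lam f).1 hfS
  refine ⟨(hasCompletedMellinEntire_of_mem_sonineK hlam hf).1, fun w hw ↦ ?_⟩
  have hG : Gammaℝ w ≠ 0 := Gammaℝ_ne_zero_of_re_pos (by linarith)
  rw [completedMellinEntire_eq_Gammaℝ_mul_of_mem_sonineK hlam hf hG,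
    sonineMellinExt_eq_mellin hlam hlam f heven hfa hFa (by simp; linarith)]

/-- Any witness of `IsCompletedRightMellin f` (`f ∈ K_λ`) IS `completedMellinEntire f` (identity
theorem). [cite: Burnol2002CRAS, §2 (TeX l.236–238)] -/
theorem IsCompletedRightMellin.eq_completedMellinEntire {lam : ℝ} (hlam : 0 < lam)
    {f : Lp ℂ 2 (volume : Measure ℝ)} (hf : f ∈ sonineK lam) {M : ℂ → ℂ}
    (hM : IsCompletedRightMellin f M) : M = completedMellinEntire (f : ℝ → ℂ) := by
  have h1 : HasCompletedMellinEntire (f : ℝ → ℂ) M :=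
    ⟨hM.1, fun s hs _ ↦ by rw [hM.2 s hs]; rfl⟩
  exact h1.eq (hasCompletedMellinEntire_of_mem_sonineK hlam hf)

/-- **The Note's evaluator predicate unfolded**: `IsSonineZ λ w Z ↔ Z ∈ K_λ ∧ ∀ f ∈ K_λ,
∫_0^∞ fZ = 𝒢_f(w)`. [cite: Burnol2002CRAS, Théorème 9 (TeX l.398–404)] -/
theorem isSonineZ_iff {lam : ℝ} (hlam : 0 < lam) {w : ℂ} {Z : Lp ℂ 2 (volume : Measure ℝ)} :
    IsSonineZ lam w Z ↔ Z ∈ sonineK lam ∧ ∀ f : Lp ℂ 2 (volume : Measure ℝ), f ∈ sonineK lam →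
      ∫ t in Ioi (0 : ℝ), (f : ℝ → ℂ) t * (Z : ℝ → ℂ) t = completedMellinEntire (f : ℝ → ℂ) w := by
  constructor
  · rintro ⟨hZ, h⟩
    exact ⟨hZ, fun f hf ↦ h f hf _ (isCompletedRightMellin_completedMellinEntire hlam hf)⟩
  · rintro ⟨hZ, h⟩
    refine ⟨hZ, fun f hf M hM ↦ ?_⟩
    rw [hM.eq_completedMellinEntire hlam hf, h f hf]

/-- **Uniqueness of the evaluator `Z_w^λ`** ("l'unique élément de `K_λ` tel que …"): the bilinear pairing
is non-degenerate on the conjugation-stable space `K_λ`. [cite: Burnol2002CRAS, Théorème 9 (TeX l.398–404)] -/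
theorem IsSonineZ.unique {lam : ℝ} (hlam : 0 < lam) {w : ℂ} {Z₁ Z₂ : Lp ℂ 2 (volume : Measure ℝ)}
    (h₁ : IsSonineZ lam w Z₁) (h₂ : IsSonineZ lam w Z₂) : Z₁ = Z₂ := by
  rw [isSonineZ_iff hlam] at h₁ h₂
  exact eq_of_pairing_eq (S := sonineK lam) (fun _ hf _ hg ↦ sub_mem_sonineK hf hg)
    (fun c _ hf ↦ smul_mem_sonineK c hf) (fun _ hf ↦ hf.1)
    (fun _ hu _ hv ↦ mem_sonineK_of_conj hu hv) h₁.1 h₂.1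
    (fun f hf ↦ by rw [h₁.2 f hf, h₂.2 f hf])

/-! ## §C. Explicit representers and the evaluators at every `w` -/

/-- For `t > 0`: `𝟙_{λ<|x|}G(t) = 𝟙_{(λ,∞)}G(t)`. [folklore] -/
private theorem indicator_abs_eq_indicator_Ioi {lam : ℝ} (G : ℝ → ℂ) {t : ℝ} (ht : 0 < t) :
    Set.indicator {x : ℝ | lam < |x|} G t = Set.indicator (Ioi lam) G t := by
  by_cases h : lam < t
  · have h1 : t ∈ {x : ℝ | lam < |x|} := by simpa [abs_of_pos ht] using h
    have h2 : t ∈ Ioi lam := h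
    rw [Set.indicator_of_mem h1, Set.indicator_of_mem h2]
  · have h1 : t ∉ {x : ℝ | lam < |x|} := by simpa [abs_of_pos ht] using h
    have h2 : t ∉ Ioi lam := h
    rw [Set.indicator_of_notMem h1, Set.indicator_of_notMem h2]

/-- `∫_0^∞ f·𝟙_{λ<|x|}G = ∫_λ^∞ f G` (`λ > 0`). [folklore] -/
private theorem setIntegral_Ioi_mul_indicator {lam : ℝ} (hlam : 0 < lam) (f G : ℝ → ℂ) :
    ∫ t in Ioi (0 : ℝ), f t * Set.indicator {x : ℝ | lam < |x|} G t = ∫ t in Ioi lam, f t * G t := by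
  calc ∫ t in Ioi (0 : ℝ), f t * Set.indicator {x : ℝ | lam < |x|} G t
      = ∫ t in Ioi (0 : ℝ), Set.indicator (Ioi lam) (fun t ↦ f t * G t) t := by
        refine setIntegral_congr_fun measurableSet_Ioi (fun t ht ↦ ?_)
        rw [indicator_abs_eq_indicator_Ioi G ht]
        by_cases h : lam < t
        · have h2 : t ∈ Ioi lam := h
          rw [Set.indicator_of_mem h2, Set.indicator_of_mem h2]
        · have h2 : t ∉ Ioi lam := h
          rw [Set.indicator_of_notMem h2, Set.indicator_of_notMem h2, mul_zero]
    _ = ∫ t in Ioi (0 : ℝ) ∩ Ioi lam, f t * G t := setIntegral_indicator measurableSet_Ioi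
    _ = ∫ t in Ioi lam, f t * G t := by rw [Ioi_inter_Ioi, sup_of_le_right hlam.le]

/-- The `L²` class of an even representer `𝟙_{λ<|x|}G` is even. [folklore] -/
private theorem toLp_indicator_mem_evenL2 {lam : ℝ} {G : ℝ → ℂ} (hG : ∀ x, G (-x) = G x)
    (hmem : MemLp (Set.indicator {x : ℝ | lam < |x|} G) 2 (volume : Measure ℝ)) :
    hmem.toLp _ ∈ evenL2 := by
  have h1 := hmem.coeFn_toLp
  have h2 := (Measure.measurePreserving_neg (volume : Measure ℝ)).quasiMeasurePreserving.ae_eq_comp h1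
  show ∀ᵐ x : ℝ, (hmem.toLp _ : ℝ → ℂ) (-x) = (hmem.toLp _ : ℝ → ℂ) x
  filter_upwards [h1, h2] with x e1 e2
  rw [e1]
  refine e2.trans ?_
  simp only [Function.comp_apply, Set.indicator_apply, Set.mem_setOf_eq, abs_neg, hG]

/-- `P_λ(𝟙_{λ<|x|}G) = 0`. [folklore] -/
private theorem cutoffProj_toLp_indicator {lam : ℝ} {G : ℝ → ℂ}
    (hmem : MemLp (Set.indicator {x : ℝ | lam < |x|} G) 2 (volume : Measure ℝ)) :
    cutoffProj lam (hmem.toLp _) = 0 := by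
  refine Lp.ext ?_
  filter_upwards [cutoffProj_coeFn lam (hmem.toLp _), hmem.coeFn_toLp,
    Lp.coeFn_zero ℂ 2 (volume : Measure ℝ)] with x e1 e2 e3
  rw [e1, e3, Pi.zero_apply]
  by_cases hx : x ∈ Icc (-lam) lam
  · rw [Set.indicator_of_mem hx, e2, Set.indicator_of_notMem]
    simp only [Set.mem_setOf_eq, not_lt]
    exact abs_le.2 ⟨hx.1, hx.2⟩
  · rw [Set.indicator_of_notMem hx]

/-- `∫_0^∞ f·[𝟙_{λ<|x|}G] = ∫_λ^∞ f G` for the `L²` class. [folklore] -/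
private theorem setIntegral_Ioi_mul_toLp_indicator {lam : ℝ} (hlam : 0 < lam) (f : ℝ → ℂ) {G : ℝ → ℂ}
    (hmem : MemLp (Set.indicator {x : ℝ | lam < |x|} G) 2 (volume : Measure ℝ)) :
    ∫ t in Ioi (0 : ℝ), f t * (hmem.toLp _ : ℝ → ℂ) t = ∫ t in Ioi lam, f t * G t := by
  rw [← setIntegral_Ioi_mul_indicator hlam f G]
  refine integral_congr_ae (ae_restrict_of_ae ?_)
  filter_upwards [hmem.coeFn_toLp] with t ht
  rw [ht]

/-- The scalar multiple of the class: `∫_0^∞ f·(c•X) = c·∫_0^∞ f·X`. [folklore] -/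
private theorem setIntegral_Ioi_mul_smul (f : ℝ → ℂ) (c : ℂ) (X : Lp ℂ 2 (volume : Measure ℝ)) :
    ∫ t in Ioi (0 : ℝ), f t * ((c • X : Lp ℂ 2 (volume : Measure ℝ)) : ℝ → ℂ) t =
      c * ∫ t in Ioi (0 : ℝ), f t * (X : ℝ → ℂ) t := by
  rw [← integral_const_mul]
  refine integral_congr_ae (ae_restrict_of_ae ?_)
  filter_upwards [Lp.coeFn_smul c X] with t ht
  rw [ht, Pi.smul_apply, smul_eq_mul]
  ring

/-- **The B-branch representer is square integrable**: `u ↦ 𝟙_{λ<|u|}C_λ(u,w) ∈ L²(ℝ)` for EVERY `w`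
(the lineage's `O(1/u)` bound; `k = 0` of `memLp_indicator_iteratedDeriv_cosKernel`).
[cite: Burnol2001CRAS, Lemme 1.3 (TeX l.358–367)] -/
theorem memLp_indicator_cosKernel {lam : ℝ} (hlam : 0 < lam) (w : ℂ) :
    MemLp (Set.indicator {x : ℝ | lam < |x|} fun u : ℝ ↦ cosKernel lam u w) 2 (volume : Measure ℝ) := by
  simpa only [iteratedDeriv_zero] using Burnol2001.memLp_indicator_iteratedDeriv_cosKernel hlam hlam 0 w

/-- **The A-branch representer is square integrable**: `x ↦ 𝟙_{λ<|x|}|x|^{−w} ∈ L²(ℝ)` for `Re w > 1/2`.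
[cite: Burnol2002CRAS, Théorème 9 (TeX l.398–404)] -/
theorem memLp_indicator_abs_cpow_neg {lam : ℝ} (hlam : 0 < lam) {w : ℂ} (hw : 1 / 2 < w.re) :
    MemLp (Set.indicator {x : ℝ | lam < |x|} fun x : ℝ ↦ ((|x| : ℝ) : ℂ) ^ (-w)) 2
      (volume : Measure ℝ) := by
  simpa only [pow_zero, one_mul] using Burnol2001.memLp_indicator_log_pow_abs_cpow hlam 0 hw

/-- **A-branch pairing** ("`∀ f ∈ K_λ ∫_0^∞ f(t)t^{−w}dt`", `Re w > 1/2`): for `f ∈ K_λ`,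
`Γ_ℝ(w)·∫_λ^∞ f(t)|t|^{−w}dt = 𝒢_f(w)`. [cite: Burnol2002CRAS, Théorème 9 (TeX l.398–404)] -/
theorem Gammaℝ_mul_setIntegral_cpow_eq {lam : ℝ} (hlam : 0 < lam) {f : Lp ℂ 2 (volume : Measure ℝ)}
    (hf : f ∈ sonineK lam) {w : ℂ} (hw : 1 / 2 < w.re) :
    Gammaℝ w * ∫ t in Ioi lam, (f : ℝ → ℂ) t * ((|t| : ℝ) : ℂ) ^ (-w) =
      completedMellinEntire (f : ℝ → ℂ) w := by
  rw [(isCompletedRightMellin_completedMellinEntire hlam hf).2 w hw, mellin]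
  congr 1
  have hnull : ∀ᵐ t : ℝ, t ∉ ({lam} : Set ℝ) :=
    compl_mem_ae_iff.mpr ((Set.toFinite _).measure_zero volume)
  have hf0 : ∀ᵐ t : ℝ, t ∈ Ioo 0 lam → (f : ℝ → ℂ) t = 0 := hf.2.1
  rw [← setIntegral_Ioi_mul_indicator hlam]
  refine integral_congr_ae ?_
  filter_upwards [ae_restrict_mem measurableSet_Ioi, ae_restrict_of_ae hnull, ae_restrict_of_ae hf0]
    with t ht hne h0
  rw [indicator_abs_eq_indicator_Ioi _ ht]
  by_cases h : lam < t
  · have h2 : t ∈ Ioi lam := h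
    rw [Set.indicator_of_mem h2, abs_of_pos ht, smul_eq_mul, mul_comm, sub_sub_cancel_left]
  · have hlt : t < lam := lt_of_le_of_ne (not_lt.1 h) hne
    have h2 : t ∉ Ioi lam := h
    rw [Set.indicator_of_notMem h2, h0 ⟨ht, hlt⟩, smul_zero, zero_mul]

/-- **B-branch pairing** (all `w` with `Γ_ℝ(1−w) ≠ 0`): for `f ∈ K_λ`,
`Γ_ℝ(1−w)·∫_λ^∞ f(u)C_λ(u,w)du = 𝒢_f(w)` — the functional equation `𝒢_f(w) = 𝒢_{𝓕f}(1−w)` followed by the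
explicit form `𝒢_{𝓕f}(1−w) = Γ_ℝ(1−w)·∫_λ^∞ (𝓕𝓕f)(u)C_λ(u,w)du` and `𝓕𝓕f = f` ("pour `Re(w) ≤ 1/2` la
première intégrale est un prolongement analytique"). [cite: Burnol2002CRAS, Théorème 9 (TeX l.398–404)] -/
theorem Gammaℝ_mul_setIntegral_cosKernel_eq {lam : ℝ} (hlam : 0 < lam)
    {f : Lp ℂ 2 (volume : Measure ℝ)} (hf : f ∈ sonineK lam) {w : ℂ} (hw : Gammaℝ (1 - w) ≠ 0) :
    Gammaℝ (1 - w) * ∫ t in Ioi lam, (f : ℝ → ℂ) t * cosKernel lam t w =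
      completedMellinEntire (f : ℝ → ℂ) w := by
  have hF : (𝓕 f : Lp ℂ 2 (volume : Measure ℝ)) ∈ sonineK lam := fourier_mem_sonineK hf
  have hFE := congrFun (completedMellinEntire_fourier_eq_of_mem_sonineK hlam hf) (1 - w)
  simp only [sub_sub_cancel] at hFE
  rw [← hFE, completedMellinEntire_eq_Gammaℝ_mul_of_mem_sonineK hlam hF hw,
    fourier_fourier_eq_self_of_mem_evenL2 hf.1, sub_sub_cancel]
  rfl

/-- **The evaluator `Z_w^λ` for `Re w > 1/2`, explicitly**: `Z = Γ_ℝ(w)·π_λ(𝟙_{λ<|x|}|x|^{−w})` IS the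
evaluator ("Pour `Re(w) > 1/2` la formule pour la projection orthogonale permet d'écrire explicitement
`X_w^λ`"). [cite: Burnol2002CRAS, Théorème 9 (TeX l.398–404)] -/
theorem isSonineZ_reprA {lam : ℝ} (hlam : 0 < lam) {w : ℂ} (hw : 1 / 2 < w.re) :
    IsSonineZ lam w (Gammaℝ w • soninProjection lam lam ((memLp_indicator_abs_cpow_neg hlam hw).toLp _)) := by
  set X := (memLp_indicator_abs_cpow_neg hlam hw).toLp _ with hX
  have hXe : X ∈ evenL2 := toLp_indicator_mem_evenL2 (fun x ↦ by simp only [abs_neg]) _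
  rw [isSonineZ_iff hlam]
  have hπK : soninProjection lam lam X ∈ sonineK lam := by
    rw [sonineK_eq_soninSpace]; exact soninProjection_mem lam lam X
  refine ⟨smul_mem_sonineK _ hπK, fun f hf ↦ ?_⟩
  rw [setIntegral_Ioi_mul_smul, setIntegral_Ioi_mul_soninProjection hf hXe, hX,
    setIntegral_Ioi_mul_toLp_indicator hlam, Gammaℝ_mul_setIntegral_cpow_eq hlam hf hw]

/-- **The evaluator `Z_w^λ` at every `w ∉ 1 + 2ℕ` (in particular for `Re w < 1`), explicitly**:
`Z = Γ_ℝ(1−w)·π_λ(𝟙_{λ<|u|}C_λ(u,w))` IS the evaluator. [cite: Burnol2002CRAS, Théorème 9 (TeX l.398–404)] -/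
theorem isSonineZ_reprB {lam : ℝ} (hlam : 0 < lam) {w : ℂ} (hw : Gammaℝ (1 - w) ≠ 0) :
    IsSonineZ lam w
      (Gammaℝ (1 - w) • soninProjection lam lam ((memLp_indicator_cosKernel hlam w).toLp _)) := by
  set X := (memLp_indicator_cosKernel hlam w).toLp _ with hX
  have hXe : X ∈ evenL2 := toLp_indicator_mem_evenL2 (fun x ↦ cosKernel_neg lam x w) _
  rw [isSonineZ_iff hlam]
  have hπK : soninProjection lam lam X ∈ sonineK lam := by
    rw [sonineK_eq_soninSpace]; exact soninProjection_mem lam lam X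
  refine ⟨smul_mem_sonineK _ hπK, fun f hf ↦ ?_⟩
  rw [setIntegral_Ioi_mul_smul, setIntegral_Ioi_mul_soninProjection hf hXe, hX,
    setIntegral_Ioi_mul_toLp_indicator hlam, Gammaℝ_mul_setIntegral_cosKernel_eq hlam hf hw]

/-! ## §D. The continuous representative on `(λ,∞)` and the jump at `λ` -/

/-- **Corollaire 5 (i) read pointwise off `[−λ,λ]`**: for an even class `q` with `P_λ q = 0` and
`R = (1 − D_λ)^{-1}P_λ𝓕q`, almost everywhere on `t > λ`:
`π_λ(q)(t) = q(t) − ∫_{[−λ,λ]} R(y)e^{2πity}dy` ("`X_w^λ(t) − t^{−w}` est la restriction à `t > λ` d'une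
fonction entière"). [cite: Burnol2002CRAS, Corollaire 5 (TeX l.321–326) and Théorème 9 (TeX l.404–407)] -/
theorem soninProjection_ae_eq_Ioi {lam : ℝ} {q R : Lp ℂ 2 (volume : Measure ℝ)} (hq : q ∈ evenL2)
    (hPq : cutoffProj lam q = 0)
    (hR : R = Ring.inverse (1 - slepianD lam) (cutoffProj lam (fourierL2 q))) :
    ∀ᵐ t : ℝ, t ∈ Ioi lam →
      ((soninProjection lam lam q : Lp ℂ 2 (volume : Measure ℝ)) : ℝ → ℂ) t =
        (q : ℝ → ℂ) t - ∫ y in Icc (-lam) lam, (R : ℝ → ℂ) y * cexp (2 * π * I * (t : ℂ) * y) := by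
  have hcor := soninProjection_eq_cor5_1 lam hq hPq
  rw [← hR, hPq, sub_zero] at hcor
  -- `R ∈ ran P_λ` and `R` is even
  have hPR : cutoffProj lam R = R := by
    rw [hR]; exact cutoffProj_resolvent' (cutoffProj_cutoffProj'' lam _)
  have hRe : R ∈ evenL2 := by
    rw [hR]
    exact resolvent_mem_evenL2 lam (cutoffProj_mem_evenL2 lam (by
      rw [fourierL2_apply]; exact fourier_mem_evenL2 hq))
  have hRc := compNeg_eq_of_mem_evenL2' hRe
  have hF := fourier_coeFn_ae_eq_setIntegral hPR hRc
  have h1 : ((soninProjection lam lam q : Lp ℂ 2 (volume : Measure ℝ)) : ℝ → ℂ) =ᵐ[volume]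
      ((q - (fourierL2 R - cutoffProj lam (fourierL2 R)) : Lp ℂ 2 (volume : Measure ℝ)) : ℝ → ℂ) := by
    rw [hcor]
  filter_upwards [h1, Lp.coeFn_sub q (fourierL2 R - cutoffProj lam (fourierL2 R)),
    Lp.coeFn_sub (fourierL2 R) (cutoffProj lam (fourierL2 R)), cutoffProj_coeFn lam (fourierL2 R), hF]
    with t e1 e2 e3 e4 e5 ht
  have hnot : t ∉ Icc (-lam) lam := fun h ↦ not_le.2 ht h.2
  rw [e1, e2, Pi.sub_apply, e3, Pi.sub_apply, e4, Set.indicator_of_notMem hnot, sub_zero,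
    fourierL2_apply, e5]

/-- **`t ↦ ∫_{[−λ,λ]} R(y)e^{2πity}dy` is continuous on `ℝ`** (restriction of an entire function).
[cite: Burnol2002CRAS, Théorème 9 (TeX l.404–407)] -/
theorem continuous_setIntegral_mul_cexp {lam : ℝ} (hlam : 0 ≤ lam) (R : Lp ℂ 2 (volume : Measure ℝ)) :
    Continuous fun t : ℝ ↦ ∫ y in Icc (-lam) lam, (R : ℝ → ℂ) y * cexp (2 * π * I * (t : ℂ) * y) :=
  (differentiable_setIntegral_mul_cexp hlam R).continuous.comp continuous_ofReal

/-- `e^{2πiλy} + e^{2πi(−λ)y} = 2cos(2πλy)`. [folklore] -/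
private theorem cexp_add_cexp_neg_eq_twoCos (lam y : ℝ) :
    cexp (2 * π * I * (lam : ℂ) * y) + cexp (2 * π * I * ((-lam : ℝ) : ℂ) * y) = twoCos lam y := by
  rw [twoCos, Complex.ofReal_cos, Complex.two_cos]
  push_cast
  congr 1 <;> congr 1 <;> ring

/-- `y ↦ R(y)e^{2πixy}` is integrable on `[−λ,λ]` for `R ∈ L²(ℝ)` and real `x`. [folklore] -/
private theorem integrableOn_mul_cexp (lam : ℝ) (R : Lp ℂ 2 (volume : Measure ℝ)) (x : ℝ) :
    IntegrableOn (fun y : ℝ ↦ (R : ℝ → ℂ) y * cexp (2 * π * I * (x : ℂ) * y)) (Icc (-lam) lam) := by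
  have h1 : IntegrableOn (R : ℝ → ℂ) (Icc (-lam) lam) := by
    rw [IntegrableOn, ← memLp_one_iff_integrable]
    exact ((Lp.memLp R).restrict (Icc (-lam) lam)).mono_exponent one_le_two
  refine h1.mul_bdd (c := 1) (Continuous.aestronglyMeasurable (by fun_prop)) ?_
  refine Eventually.of_forall fun y ↦ ?_
  rw [show (2 * π * I * (x : ℂ) * (y : ℂ)) = ((2 * π * x * y : ℝ) : ℂ) * I by push_cast; ring,
    Complex.norm_exp_ofReal_mul_I]

/-- **The value at `λ`**: for an even class `R`, `∫_{[−λ,λ]} R(y)e^{2πiλy}dy = ½∫_ℝ R·P_λ(2cos 2πλ·)`.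
[cite: Burnol2002CRAS, Définition 1 (TeX l.346–352)] -/
theorem setIntegral_mul_cexp_self_eq_half {lam : ℝ} {R : Lp ℂ 2 (volume : Measure ℝ)}
    (hRe : R ∈ evenL2) :
    ∫ y in Icc (-lam) lam, (R : ℝ → ℂ) y * cexp (2 * π * I * (lam : ℂ) * y) =
      (1 / 2 : ℂ) * ∫ x, (R : ℝ → ℂ) x * ((cosCut lam : Lp ℂ 2 (volume : Measure ℝ)) : ℝ → ℂ) x := by
  have hRc := compNeg_eq_of_mem_evenL2' hRe
  have hsymm := setIntegral_mul_cexp_neg (lam := lam) hRc (lam : ℂ)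
  -- `2·∫ R e^{2πiλy} = ∫ R·(e^{2πiλy} + e^{−2πiλy}) = ∫ R·2cos = ∫_ℝ R·cosCut`
  have h2 : 2 * ∫ y in Icc (-lam) lam, (R : ℝ → ℂ) y * cexp (2 * π * I * (lam : ℂ) * y) =
      ∫ y in Icc (-lam) lam, (R : ℝ → ℂ) y * twoCos lam y := by
    rw [two_mul]
    nth_rewrite 2 [← hsymm]
    rw [show (-(lam : ℂ)) = ((-lam : ℝ) : ℂ) by push_cast; ring,
      ← integral_add (integrableOn_mul_cexp lam R lam) (integrableOn_mul_cexp lam R (-lam))]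
    refine integral_congr_ae (Eventually.of_forall fun y ↦ ?_)
    dsimp only
    rw [← mul_add, cexp_add_cexp_neg_eq_twoCos]
  have h3 : ∫ y in Icc (-lam) lam, (R : ℝ → ℂ) y * twoCos lam y =
      ∫ x, (R : ℝ → ℂ) x * ((cosCut lam : Lp ℂ 2 (volume : Measure ℝ)) : ℝ → ℂ) x := by
    rw [← integral_indicator measurableSet_Icc]
    refine integral_congr_ae ?_
    filter_upwards [cosCut_coeFn lam] with x hx
    rw [hx]
    by_cases h : x ∈ Icc (-lam) lam
    · rw [Set.indicator_of_mem h, Set.indicator_of_mem h]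
    · rw [Set.indicator_of_notMem h, Set.indicator_of_notMem h, mul_zero]
  rw [← h3, ← h2]
  ring

/-- **The symmetric computation** behind Théorème 9: for any class `q` and
`R = (1 − D_λ)^{-1}P_λ𝓕q`, `∫_ℝ R·P_λ(2cos 2πλ·) = ½∫_ℝ q·𝓕(h_+^λ + h_−^λ)` — move `(1 − D_λ)^{-1}`, `P_λ`,
`𝓕` across the bilinear pairing and use `(1 − D_λ)^{-1}P_λ(2cos) = ½(h_+ + h_−)`, `P_λ h_± = h_±`.
[cite: Burnol2002CRAS, Théorème 9 (TeX l.398–428)] -/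
theorem integral_resolvent_mul_cosCut {lam : ℝ} (q R : Lp ℂ 2 (volume : Measure ℝ))
    (hR : R = Ring.inverse (1 - slepianD lam) (cutoffProj lam (fourierL2 q))) :
    ∫ x, (R : ℝ → ℂ) x * ((cosCut lam : Lp ℂ 2 (volume : Measure ℝ)) : ℝ → ℂ) x =
      (1 / 2 : ℂ) * ∫ x, (q : ℝ → ℂ) x *
        ((fourierL2 (hPlus lam + hMinus lam) : Lp ℂ 2 (volume : Measure ℝ)) : ℝ → ℂ) x := by
  rw [hR, integral_resolvent_mul, resolvent_cosCut]
  have e1 : ∫ x, ((cutoffProj lam (fourierL2 q) : Lp ℂ 2 (volume : Measure ℝ)) : ℝ → ℂ) x *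
      (((1 / 2 : ℂ) • (hPlus lam + hMinus lam) : Lp ℂ 2 (volume : Measure ℝ)) : ℝ → ℂ) x =
      (1 / 2 : ℂ) * ∫ x, ((cutoffProj lam (fourierL2 q) : Lp ℂ 2 (volume : Measure ℝ)) : ℝ → ℂ) x *
        ((hPlus lam + hMinus lam : Lp ℂ 2 (volume : Measure ℝ)) : ℝ → ℂ) x := by
    rw [← integral_const_mul]
    refine integral_congr_ae ?_
    filter_upwards [Lp.coeFn_smul (1 / 2 : ℂ) (hPlus lam + hMinus lam)] with x hx
    rw [hx, Pi.smul_apply, smul_eq_mul]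
    ring
  rw [e1, integral_cutoffProj_mul, map_add, cutoffProj_hPlus, cutoffProj_hMinus, integral_fourierL2_mul]

/-- **`𝓕(h_+^λ + h_−^λ) = ψ_−^λ − ψ_+^λ` a.e. on `ℝ`** (`𝓕h_± = ∫_{[−λ,λ]}h_±(y)e^{2πixy}dy` and Définition 2).
[cite: Burnol2002CRAS, Définition 2 (TeX l.361–367)] -/
theorem fourierL2_hPlus_add_hMinus_coeFn (lam : ℝ) :
    ∀ᵐ x : ℝ, ((fourierL2 (hPlus lam + hMinus lam) : Lp ℂ 2 (volume : Measure ℝ)) : ℝ → ℂ) x =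
      psiMinus lam x - psiPlus lam x := by
  have hP := fourier_coeFn_ae_eq_setIntegral (cutoffProj_hPlus lam) (compNeg_hPlus lam)
  have hM := fourier_coeFn_ae_eq_setIntegral (cutoffProj_hMinus lam) (compNeg_hMinus lam)
  rw [fourierL2_apply, FourierTransform.fourier_add]
  filter_upwards [hP, hM, Lp.coeFn_add (𝓕 (hPlus lam) : Lp ℂ 2 (volume : Measure ℝ))
    (𝓕 (hMinus lam) : Lp ℂ 2 (volume : Measure ℝ))] with x e1 e2 e3
  rw [e3, Pi.add_apply, e1, e2, psiPlus, psiMinus]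
  ring

/-- `ψ_+^λ − ψ_−^λ` is even on `ℝ`. [cite: Burnol2002CRAS, Théorème 7 (TeX l.369–375)] -/
theorem psiPlus_sub_psiMinus_neg (lam x : ℝ) :
    psiPlus lam ((-x : ℝ) : ℂ) - psiMinus lam ((-x : ℝ) : ℂ) = psiPlus lam x - psiMinus lam x := by
  push_cast
  rw [psiPlus_neg, psiMinus_neg]

/-- **The jump term at `λ`, evaluated**: for an even representer `q = 𝟙_{λ<|x|}G` (`G` even,
`q ∈ L²`) and `R = (1 − D_λ)^{-1}P_λ𝓕q`,
`∫_{[−λ,λ]} R(y)e^{2πiλy}dy = −½∫_λ^∞ (ψ_+^λ − ψ_−^λ)(t)G(t)dt`.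
[cite: Burnol2002CRAS, Théorème 9 (TeX l.398–428)] -/
theorem fourierResolvent_apply_self {lam : ℝ} (hlam : 0 < lam) {G : ℝ → ℂ} (hG : ∀ x, G (-x) = G x)
    (hmem : MemLp (Set.indicator {x : ℝ | lam < |x|} G) 2 (volume : Measure ℝ))
    {R : Lp ℂ 2 (volume : Measure ℝ)}
    (hR : R = Ring.inverse (1 - slepianD lam) (cutoffProj lam (fourierL2 (hmem.toLp _)))) :
    ∫ y in Icc (-lam) lam, (R : ℝ → ℂ) y * cexp (2 * π * I * (lam : ℂ) * y) =
      -(1 / 2 : ℂ) * ∫ t in Ioi lam, (psiPlus lam t - psiMinus lam t) * G t := by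
  set q := hmem.toLp _ with hq
  have hqe : q ∈ evenL2 := toLp_indicator_mem_evenL2 hG hmem
  have hRe : R ∈ evenL2 := by
    rw [hR]
    exact resolvent_mem_evenL2 lam (cutoffProj_mem_evenL2 lam (by
      rw [fourierL2_apply]; exact fourier_mem_evenL2 hqe))
  rw [setIntegral_mul_cexp_self_eq_half hRe, integral_resolvent_mul_cosCut q R hR]
  -- `∫ q·𝓕(h₊+h₋) = ∫ 𝟙G·(ψ₋ − ψ₊) = −2∫_λ^∞ (ψ₊ − ψ₋)G`
  set M : Lp ℂ 2 (volume : Measure ℝ) := fourierL2 (hPlus lam + hMinus lam) with hM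
  have hint : Integrable (fun x : ℝ ↦ (psiPlus lam x - psiMinus lam x) *
      Set.indicator {x : ℝ | lam < |x|} G x) := by
    refine (integrable_mul_Lp M q).neg.congr ?_
    filter_upwards [fourierL2_hPlus_add_hMinus_coeFn lam, hmem.coeFn_toLp] with x e1 e2
    simp only [Pi.neg_apply]
    rw [← hM] at e1
    rw [← hq] at e2
    rw [e1, e2]
    ring
  have e : ∫ x, (q : ℝ → ℂ) x * (M : ℝ → ℂ) x =
      -∫ x : ℝ, (psiPlus lam x - psiMinus lam x) * Set.indicator {x : ℝ | lam < |x|} G x := by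
    rw [← integral_neg]
    refine integral_congr_ae ?_
    filter_upwards [fourierL2_hPlus_add_hMinus_coeFn lam, hmem.coeFn_toLp] with x e1 e2
    rw [← hM] at e1
    rw [← hq] at e2
    rw [e1, e2]
    ring
  rw [e, Burnol2001.integral_mul_indicator_eq_two_mul_setIntegral hlam
    (Eventually.of_forall fun x ↦ psiPlus_sub_psiMinus_neg lam x) hG hint]
  ring

/-! ## §E. The jump of the explicit evaluators; Théorème 9 on `Re w > 1/2` -/

/-- **Uniqueness of the jump**: two functions continuous on `(λ,∞)`, both a.e. equal there to the same
class `Z`, with right limits `c₁`, `c₂` at `λ`, have `c₁ = c₂` (they coincide on the open set `(λ,∞)`).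
[folklore] -/
private theorem jump_unique {lam : ℝ} {Z : Lp ℂ 2 (volume : Measure ℝ)} {g₁ g₂ : ℝ → ℂ} {c₁ c₂ : ℂ}
    (h₁ : ContinuousOn g₁ (Ioi lam)) (h₁' : ∀ᵐ t : ℝ, t ∈ Ioi lam → (Z : ℝ → ℂ) t = g₁ t)
    (hc₁ : Tendsto g₁ (𝓝[>] lam) (𝓝 c₁))
    (h₂ : ContinuousOn g₂ (Ioi lam)) (h₂' : ∀ᵐ t : ℝ, t ∈ Ioi lam → (Z : ℝ → ℂ) t = g₂ t)
    (hc₂ : Tendsto g₂ (𝓝[>] lam) (𝓝 c₂)) : c₁ = c₂ := by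
  have hae : g₁ =ᵐ[volume.restrict (Ioi lam)] g₂ := by
    rw [Filter.EventuallyEq, ae_restrict_iff' measurableSet_Ioi]
    filter_upwards [h₁', h₂'] with t e1 e2 ht
    rw [← e1 ht, e2 ht]
  have heq : EqOn g₁ g₂ (Ioi lam) := Measure.eqOn_open_of_ae_eq hae isOpen_Ioi h₁ h₂
  have hc₂' : Tendsto g₁ (𝓝[>] lam) (𝓝 c₂) :=
    hc₂.congr' (eventually_nhdsWithin_of_forall fun t ht ↦ (heq ht).symm)
  exact tendsto_nhds_unique hc₁ hc₂'

/-- **The continuous representative and the jump of `Γ·π_λ(𝟙_{λ<|x|}G)`**: if `G` is even, continuous at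
every point of `[λ,∞)`, and `𝟙_{λ<|x|}G ∈ L²`, then for every scalar `Γ`, on `(λ,∞)` the class
`Γ·π_λ(𝟙_{λ<|x|}G)` is a.e. the continuous function `g(t) = Γ(G(t) − ∫_{[−λ,λ]}R(y)e^{2πity}dy)` whose
right limit at `λ` is `Γ(G(λ) + ½∫_λ^∞ (ψ_+^λ − ψ_−^λ)G)`.
[cite: Burnol2002CRAS, Théorème 9 (TeX l.404–407, 424–428)] -/
theorem exists_jump_repr {lam : ℝ} (hlam : 0 < lam) {G : ℝ → ℂ} (hG : ∀ x, G (-x) = G x)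
    (hGc : ∀ t, lam ≤ t → ContinuousAt G t)
    (hmem : MemLp (Set.indicator {x : ℝ | lam < |x|} G) 2 (volume : Measure ℝ)) (Γ : ℂ) :
    ∃ g : ℝ → ℂ, ContinuousOn g (Ioi lam) ∧
      (∀ᵐ t : ℝ, t ∈ Ioi lam →
        ((Γ • soninProjection lam lam (hmem.toLp _) : Lp ℂ 2 (volume : Measure ℝ)) : ℝ → ℂ) t = g t) ∧
      Tendsto g (𝓝[>] lam)
        (𝓝 (Γ * (G lam + (1 / 2 : ℂ) * ∫ t in Ioi lam, (psiPlus lam t - psiMinus lam t) * G t))) := by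
  set q := hmem.toLp _ with hq
  set R := Ring.inverse (1 - slepianD lam) (cutoffProj lam (fourierL2 q)) with hR
  set Φ : ℝ → ℂ := fun t ↦ ∫ y in Icc (-lam) lam, (R : ℝ → ℂ) y * cexp (2 * π * I * (t : ℂ) * y)
    with hΦ
  have hqe : q ∈ evenL2 := toLp_indicator_mem_evenL2 hG hmem
  have hPq : cutoffProj lam q = 0 := cutoffProj_toLp_indicator hmem
  have hae := soninProjection_ae_eq_Ioi hqe hPq hR
  have hΦc : Continuous Φ := continuous_setIntegral_mul_cexp hlam.le R
  have hΦlam : Φ lam = -(1 / 2 : ℂ) * ∫ t in Ioi lam, (psiPlus lam t - psiMinus lam t) * G t :=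
    fourierResolvent_apply_self hlam hG hmem hR
  refine ⟨fun t ↦ Γ * (G t - Φ t), ?_, ?_, ?_⟩
  · intro t ht
    exact (continuousAt_const.mul ((hGc t (le_of_lt ht)).sub hΦc.continuousAt)).continuousWithinAt
  · filter_upwards [hae, Lp.coeFn_smul Γ (soninProjection lam lam q), hmem.coeFn_toLp] with t e1 e2 e3 ht
    rw [e2, Pi.smul_apply, smul_eq_mul, e1 ht, ← hq] at *
    rw [show (q : ℝ → ℂ) t = G t by
      rw [hq, e3, Set.indicator_of_mem]
      simp only [Set.mem_setOf_eq]
      rw [abs_of_pos (hlam.trans ht)]; exact ht]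
  · have hct : ContinuousAt (fun t ↦ Γ * (G t - Φ t)) lam :=
      continuousAt_const.mul ((hGc lam le_rfl).sub hΦc.continuousAt)
    have := hct.continuousWithinAt (s := Ioi lam)
    rw [ContinuousWithinAt, hΦlam] at this
    convert this using 2
    ring

/-- `λ^{1/2 − w} = √λ·λ^{−w}` for `λ > 0`. [folklore] -/
private theorem cpow_half_sub {lam : ℝ} (hlam : 0 < lam) (w : ℂ) :
    (lam : ℂ) ^ (1 / 2 - w) = (Real.sqrt lam : ℂ) * (lam : ℂ) ^ (-w) := by
  rw [sub_eq_add_neg, Complex.cpow_add _ _ (ofReal_ne_zero.mpr hlam.ne'), Real.sqrt_eq_rpow,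
    Complex.ofReal_cpow hlam.le]
  congr 2
  push_cast
  ring

/-- For `Re w > 1/2`, `(ψ_+^λ − ψ_−^λ)(t)·t^{−w}` is integrable on `(λ,∞)` (Cauchy–Schwarz: `ψ_+ − ψ_−` is
a.e. the `L²` class `−𝓕(h_+ + h_−)` and `𝟙_{t>λ}t^{−w} ∈ L²`); so the Bochner integral in `sonineEFormula`
is a genuine integral there. [cite: Burnol2002CRAS, Théorème 8 (TeX l.383–386)] -/
theorem integrableOn_psi_mul_cpow {lam : ℝ} (hlam : 0 < lam) {w : ℂ} (hw : 1 / 2 < w.re) :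
    IntegrableOn (fun t : ℝ ↦ (psiPlus lam t - psiMinus lam t) * (t : ℂ) ^ (-w)) (Ioi lam) := by
  set M : Lp ℂ 2 (volume : Measure ℝ) := fourierL2 (hPlus lam + hMinus lam) with hM
  have hint : Integrable (fun x : ℝ ↦ -(M : ℝ → ℂ) x *
      Set.indicator {x : ℝ | lam < |x|} (fun x : ℝ ↦ ((|x| : ℝ) : ℂ) ^ (-w)) x) :=
    ((Lp.memLp M).neg.integrable_mul (memLp_indicator_abs_cpow_neg hlam hw))
  have h2 : IntegrableOn (fun x : ℝ ↦ -(M : ℝ → ℂ) x *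
      Set.indicator {x : ℝ | lam < |x|} (fun x : ℝ ↦ ((|x| : ℝ) : ℂ) ^ (-w)) x) (Ioi lam) :=
    hint.integrableOn
  refine h2.congr ?_
  rw [Filter.EventuallyEq, ae_restrict_iff' measurableSet_Ioi]
  filter_upwards [fourierL2_hPlus_add_hMinus_coeFn lam] with t e1 ht
  have ht0 : 0 < t := hlam.trans ht
  have hmem : t ∈ {x : ℝ | lam < |x|} := by
    simp only [Set.mem_setOf_eq]; rwa [abs_of_pos ht0]
  rw [← hM] at e1
  rw [e1, Set.indicator_of_mem hmem, abs_of_pos ht0]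
  ring

/-- **Théorème 9 on the half-plane `Re w > 1/2`** (the printed formula of Théorème 8 equals `√λ` times
the jump of the explicit evaluator): `sonineEFormula λ w = √λ · Γ_ℝ(w)(λ^{−w} + ½∫_λ^∞(ψ_+ − ψ_−)t^{−w}dt)`.
[cite: Burnol2002CRAS, Théorèmes 8–9 (TeX l.383–386, 424–428)] -/
theorem sonineEFormula_eq_sqrt_mul_jump {lam : ℝ} (hlam : 0 < lam) (w : ℂ) :
    sonineEFormula lam w = (Real.sqrt lam : ℂ) * (Gammaℝ w * ((lam : ℂ) ^ (-w) +
      (1 / 2 : ℂ) * ∫ t in Ioi lam, (psiPlus lam t - psiMinus lam t) * (t : ℂ) ^ (-w))) := by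
  rw [sonineEFormula, cpow_half_sub hlam]
  ring

/-- The jump datum of the A-branch in the shape of `exists_jump_repr` (`G(t) = |t|^{−w}`) equals the one
in the shape of `sonineEFormula` (`t^{−w}` on `t > λ > 0`). [folklore] -/
private theorem jumpA_eq {lam : ℝ} (hlam : 0 < lam) (w : ℂ) :
    Gammaℝ w * ((((|lam| : ℝ) : ℂ)) ^ (-w) + (1 / 2 : ℂ) *
        ∫ t in Ioi lam, (psiPlus lam t - psiMinus lam t) * (((|t| : ℝ) : ℂ) ^ (-w))) =
      Gammaℝ w * ((lam : ℂ) ^ (-w) +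
        (1 / 2 : ℂ) * ∫ t in Ioi lam, (psiPlus lam t - psiMinus lam t) * (t : ℂ) ^ (-w)) := by
  have h : ∫ t in Ioi lam, (psiPlus lam t - psiMinus lam t) * (((|t| : ℝ) : ℂ) ^ (-w)) =
      ∫ t in Ioi lam, (psiPlus lam t - psiMinus lam t) * (t : ℂ) ^ (-w) :=
    setIntegral_congr_fun measurableSet_Ioi (fun t ht ↦ by
      simp only [abs_of_pos (hlam.trans ht)])
  rw [abs_of_pos hlam, h]

/-- **Théorème 9 for `Re w > 1/2`, as typed**: for any `E` with the printed values (`IsSonineE`) and any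
evaluator `Z` at `w` (`IsSonineZ`), `Z` has a continuous representative on `(λ,∞)` with a right limit
`c` at `λ` and `E(w) = √λ·c`. [cite: Burnol2002CRAS, Théorème 9 (TeX l.424–428)] -/
theorem sonineE_eq_sqrt_mul_jump_of_re_gt_half {lam : ℝ} (hlam : 0 < lam) {E : ℂ → ℂ}
    (hE : IsSonineE lam E) {w : ℂ} (hw : 1 / 2 < w.re) {Z : Lp ℂ 2 (volume : Measure ℝ)}
    (hZ : IsSonineZ lam w Z) :
    ∃ (g : ℝ → ℂ) (c : ℂ), ContinuousOn g (Ioi lam) ∧ (∀ᵐ t : ℝ, t ∈ Ioi lam → Z t = g t) ∧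
      Tendsto g (𝓝[>] lam) (𝓝 c) ∧ E w = (Real.sqrt lam : ℂ) * c := by
  have hZA := isSonineZ_reprA hlam hw
  have heq : Z = Gammaℝ w • soninProjection lam lam ((memLp_indicator_abs_cpow_neg hlam hw).toLp _) :=
    hZ.unique hlam hZA
  have hGc : ∀ t, lam ≤ t → ContinuousAt (fun x : ℝ ↦ ((|x| : ℝ) : ℂ) ^ (-w)) t := fun t ht ↦
    (continuousAt_ofReal_cpow_const _ _ (Or.inr (abs_pos.2 (hlam.trans_le ht).ne').ne')).comp
      continuous_abs.continuousAt
  obtain ⟨g, hgc, hgae, hglim⟩ := exists_jump_repr hlam (fun x ↦ by simp only [abs_neg]) hGc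
    (memLp_indicator_abs_cpow_neg hlam hw) (Gammaℝ w)
  refine ⟨g, _, hgc, ?_, hglim, ?_⟩
  · rw [heq]; exact hgae
  · rw [hE.2 w (by linarith), sonineEFormula_eq_sqrt_mul_jump hlam, jumpA_eq hlam]

/-! ## §F. Analyticity of the B-branch jump and Théorème 9 at every `w` -/

/-- `Γ_ℝ` is complex differentiable wherever it does not vanish (`Γ_ℝ = ((Γ_ℝ)⁻¹)⁻¹` with `(Γ_ℝ)⁻¹`
entire). [folklore] -/
private theorem differentiableAt_Gammaℝ' {w : ℂ} (hw : Gammaℝ w ≠ 0) : DifferentiableAt ℂ Gammaℝ w := by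
  have h1 : DifferentiableAt ℂ (fun s : ℂ ↦ ((Gammaℝ s)⁻¹)⁻¹) w :=
    differentiable_Gammaℝ_inv.differentiableAt.inv (inv_ne_zero hw)
  have heq : (fun s : ℂ ↦ ((Gammaℝ s)⁻¹)⁻¹) = Gammaℝ := funext fun s ↦ inv_inv _
  rwa [heq] at h1

/-- **The B-branch jump `c_B(w) = Γ_ℝ(1−w)(C_λ(λ,w) + ½∫_λ^∞ (ψ_+ − ψ_−)(t)C_λ(t,w)dt)` is holomorphic on
`Re w < 1`**: the integral is the lineage's entire `sonineMellinExt λ λ m` of the `L²` class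
`m = −𝓕(h_+ + h_−) = ψ_+ − ψ_−` (a.e.). [cite: Burnol2002CRAS, Théorème 9 (TeX l.424–428); Burnol2001CRAS, eq. (1.2) (TeX l.320–332)] -/
theorem differentiableOn_jumpB {lam : ℝ} (hlam : 0 < lam) :
    DifferentiableOn ℂ (fun w : ℂ ↦ Gammaℝ (1 - w) * (cosKernel lam lam w +
      (1 / 2 : ℂ) * ∫ t in Ioi lam, (psiPlus lam t - psiMinus lam t) * cosKernel lam t w))
      {w : ℂ | w.re < 1} := by
  set M : Lp ℂ 2 (volume : Measure ℝ) := -fourierL2 (hPlus lam + hMinus lam) with hM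
  have hMae : ∀ᵐ t : ℝ, (M : ℝ → ℂ) t = psiPlus lam t - psiMinus lam t := by
    filter_upwards [Lp.coeFn_neg (fourierL2 (hPlus lam + hMinus lam)),
      fourierL2_hPlus_add_hMinus_coeFn lam] with t e1 e2
    rw [e1, Pi.neg_apply, e2]; ring
  have hint : ∀ w : ℂ, ∫ t in Ioi lam, (psiPlus lam t - psiMinus lam t) * cosKernel lam t w =
      sonineMellinExt lam lam (M : ℝ → ℂ) w := by
    intro w
    rw [sonineMellinExt]
    refine integral_congr_ae (ae_restrict_of_ae ?_)
    filter_upwards [hMae] with t ht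
    rw [ht]
  simp_rw [hint]
  intro w hw
  have hG : Gammaℝ (1 - w) ≠ 0 := Gammaℝ_ne_zero_of_re_pos (by simp; linarith [hw.out])
  refine DifferentiableAt.differentiableWithinAt ?_
  refine DifferentiableAt.mul ?_ ?_
  · exact (differentiableAt_Gammaℝ' hG).comp w ((differentiableAt_const _).sub differentiableAt_id)
  · exact ((differentiable_cosKernel hlam hlam.ne').differentiableAt).add
      ((differentiableAt_const _).mul (differentiable_sonineMellinExt hlam hlam M).differentiableAt)

/-- **On the strip `1/2 < Re w < 1` the two explicit evaluators have the same jump**, because they are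
the SAME vector of `K_λ` (uniqueness of the evaluator) and the jump is read off the a.e. class
(`jump_unique`). [cite: Burnol2002CRAS, Théorème 9 (TeX l.398–407)] -/
theorem jumpA_eq_jumpB {lam : ℝ} (hlam : 0 < lam) {w : ℂ} (hw : 1 / 2 < w.re) (hw1 : w.re < 1) :
    Gammaℝ w * ((lam : ℂ) ^ (-w) +
        (1 / 2 : ℂ) * ∫ t in Ioi lam, (psiPlus lam t - psiMinus lam t) * (t : ℂ) ^ (-w)) =
      Gammaℝ (1 - w) * (cosKernel lam lam w +
        (1 / 2 : ℂ) * ∫ t in Ioi lam, (psiPlus lam t - psiMinus lam t) * cosKernel lam t w) := by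
  have hG : Gammaℝ (1 - w) ≠ 0 := Gammaℝ_ne_zero_of_re_pos (by simp; linarith)
  have hZA := isSonineZ_reprA hlam hw
  have hZB := isSonineZ_reprB hlam hG
  have heq := hZA.unique hlam hZB
  have hGcA : ∀ t, lam ≤ t → ContinuousAt (fun x : ℝ ↦ ((|x| : ℝ) : ℂ) ^ (-w)) t := fun t ht ↦
    (continuousAt_ofReal_cpow_const _ _ (Or.inr (abs_pos.2 (hlam.trans_le ht).ne').ne')).comp
      continuous_abs.continuousAt
  have hGcB : ∀ t, lam ≤ t → ContinuousAt (fun x : ℝ ↦ cosKernel lam x w) t := fun t ht ↦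
    (continuousOn_cosKernel hlam w).continuousAt (isOpen_ne.mem_nhds (hlam.trans_le ht).ne')
  obtain ⟨gA, hA1, hA2, hA3⟩ := exists_jump_repr hlam (fun x ↦ by simp only [abs_neg]) hGcA
    (memLp_indicator_abs_cpow_neg hlam hw) (Gammaℝ w)
  obtain ⟨gB, hB1, hB2, hB3⟩ := exists_jump_repr hlam (fun x ↦ cosKernel_neg lam x w) hGcB
    (memLp_indicator_cosKernel hlam w) (Gammaℝ (1 - w))
  rw [← heq] at hB2
  rw [← jumpA_eq hlam]
  exact jump_unique hA1 hA2 hA3 hB1 hB2 hB3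

/-- **`ℰ = √λ·c_B` on the half-plane `Re w < 1`** for every `ℰ` with the printed values: both sides are
holomorphic there and agree on the strip `1/2 < Re w < 1` (Théorème 9 on `Re w > 1/2` + `jumpA_eq_jumpB`);
identity theorem. [cite: Burnol2002CRAS, Théorème 9 (TeX l.424–428)] -/
theorem sonineE_eq_sqrt_mul_jumpB {lam : ℝ} (hlam : 0 < lam) {E : ℂ → ℂ} (hE : IsSonineE lam E)
    {w : ℂ} (hw : w.re < 1) :
    E w = (Real.sqrt lam : ℂ) * (Gammaℝ (1 - w) * (cosKernel lam lam w +
      (1 / 2 : ℂ) * ∫ t in Ioi lam, (psiPlus lam t - psiMinus lam t) * cosKernel lam t w)) := by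
  set U : Set ℂ := {w : ℂ | w.re < 1} with hU
  have hUo : IsOpen U := isOpen_lt Complex.continuous_re continuous_const
  have hconn : IsPreconnected U := (convex_halfSpace_re_lt (1 : ℝ)).isPreconnected
  set cB : ℂ → ℂ := fun w ↦ (Real.sqrt lam : ℂ) * (Gammaℝ (1 - w) * (cosKernel lam lam w +
      (1 / 2 : ℂ) * ∫ t in Ioi lam, (psiPlus lam t - psiMinus lam t) * cosKernel lam t w)) with hcB
  have h1 : AnalyticOnNhd ℂ E U := (hE.1.differentiableOn).analyticOnNhd hUo
  have h2 : AnalyticOnNhd ℂ cB U :=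
    ((differentiableOn_const _).mul (differentiableOn_jumpB hlam)).analyticOnNhd hUo
  have hz₀ : (3 / 4 : ℂ) ∈ U := by simp [hU]; norm_num
  have hS : IsOpen {w : ℂ | 1 / 2 < w.re ∧ w.re < 1} :=
    (isOpen_lt continuous_const Complex.continuous_re).inter
      (isOpen_lt Complex.continuous_re continuous_const)
  have hmem : (3 / 4 : ℂ) ∈ {w : ℂ | 1 / 2 < w.re ∧ w.re < 1} := by
    simp only [mem_setOf_eq]; norm_num
  have hev : E =ᶠ[𝓝 (3 / 4 : ℂ)] cB := by
    filter_upwards [hS.mem_nhds hmem] with z hz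
    rw [hcB]
    dsimp only
    rw [← jumpA_eq_jumpB hlam hz.1 hz.2, ← sonineEFormula_eq_sqrt_mul_jump hlam,
      hE.2 z (by linarith [hz.1])]
  exact h1.eqOn_of_preconnected_of_eventuallyEq h2 hconn hz₀ hev hw

/-- **Théorème 9 holds** (Burnol 2002, Théorème 9, as typed in `BurnolSonineStructureFunction.lean`):
for every `λ > 0`, every `ℰ` with the printed values of Théorème 8 on `Re w > 0`, every `w ∈ ℂ` and
every evaluator `Z = Z_w^λ`, the class `Z` has a continuous representative on `(λ,∞)` with a right limit
`c` at `λ`, and `ℰ(w) = √λ·c`. For `Re w > 1/2` the evaluator is `Γ_ℝ(w)π_λ(𝟙|t|^{−w})` and the identity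
is the `B`-symmetric computation of §D–§E; for `Re w ≤ 1/2` the evaluator is
`Γ_ℝ(1−w)π_λ(𝟙C_λ(t,w))` and the identity is continued from the strip `1/2 < Re w < 1`.
[cite: Burnol2002CRAS, Théorème 9 (TeX l.424–428)] -/
theorem Burnol2002CRAS_thm9_holds : Burnol2002CRAS_thm9 := by
  intro lam hlam E hE w Z hZ
  by_cases hw : 1 / 2 < w.re
  · exact sonineE_eq_sqrt_mul_jump_of_re_gt_half hlam hE hw hZ
  · have hw1 : w.re < 1 := by linarith [not_lt.1 hw]
    have hG : Gammaℝ (1 - w) ≠ 0 := Gammaℝ_ne_zero_of_re_pos (by simp; linarith)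
    have hZB := isSonineZ_reprB hlam hG
    have heq := hZ.unique hlam hZB
    have hGcB : ∀ t, lam ≤ t → ContinuousAt (fun x : ℝ ↦ cosKernel lam x w) t := fun t ht ↦
      (continuousOn_cosKernel hlam w).continuousAt (isOpen_ne.mem_nhds (hlam.trans_le ht).ne')
    obtain ⟨g, hgc, hgae, hglim⟩ := exists_jump_repr hlam (fun x ↦ cosKernel_neg lam x w) hGcB
      (memLp_indicator_cosKernel hlam w) (Gammaℝ (1 - w))
    refine ⟨g, _, hgc, ?_, hglim, sonineE_eq_sqrt_mul_jumpB hlam hE hw1⟩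
    rw [heq]; exact hgae

end Burnol2002

end Literature.Analysis.DeBrangesSpaces
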